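import Literature.Probability.Percolation.FourArmGarbanCircuitBits
import Literature.Probability.Percolation.LatticeSymmetry
import HarnessLib

/-!
# Garban's multi-scale four-arm bound: the four-arm event around an arbitrary centre

Topic `Literature/Probability/Percolation`; support file for the named fact
`Literature.Probability.Percolation.Garban2011_fourArm_multiscale` (`FourArmGarban.lean`;
C. Garban, Appendix B of O. Schramm, S. Smirnov, Ann. Probab. 39 (2011), Lemma B.1). Bond
percolation on `ℤ²`. One definition (the recentred event), no named fact.

The four-arm probability of the named fact is that of the cluster-form event
`fourArmTwoClusters m n` around the ORIGIN, while the proof of Lemma B.1 estimates the four-arm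
event around the centre `c_j` of each mesoscopic square `Q_j` (SS11 App. B, (B.2):
"`P⁴(r, R) ≍ P[Q_j pivotal for X]`", with `P⁴_μ(z, r, R)` the four-arm event at `z`,
assumption (1.3)/(eqpivo) of the paper). Every proof of the missing separation input `sep` of
`GarbanExplorationData` (`FourArmGarbanConditional.lean`) therefore starts by moving the event
to `c_j`, which by translation invariance of `P_p` costs nothing:

* `fourArmTwoClustersAt c m n` — two open crossings of `c + A_{m,n}` from `‖· - c‖_∞ = m` to
  `‖· - c‖_∞ = n` whose inner endpoints are not joined by an open path of `c + A_{m,n}`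
  (`fourArmTwoClusters m n` recentred; `fourArmTwoClustersAt_zero`);
* `fourArmTwoClustersAt_eq_preimage` — it is the translate of the event at the origin,
  `relabel_shift_mem_fourArmTwoClustersAt` — transport by translations
  (`relabel_mem_openConnIn`, `LatticeSymmetry.lean`);
* `real_fourArmTwoClustersAt` — **`P_p(fourArmTwoClustersAt c m n) = P_p(fourArmTwoClusters m n)`**
  for every `p` and `c` (`bondPercolation_real_preimage_shift`).

## References

* O. Schramm, S. Smirnov (appendix by C. Garban), Ann. Probab. 39 (2011), (1.3) and Appendix B,
  (B.2) [SchrammSmirnov2011].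
* G. Grimmett, *Percolation*, 2nd ed. (1999), §1.6 (translation invariance of `P_p`)
  [GrimmettPercolation1999].

Tree: `fourArmTwoClusters`, `siteSphere`, `sqAnnulus` (`FourArmGarban.lean`),
`relabel_mem_openConnIn` (`LatticeSymmetry.lean`), `relabel_shift_neg_relabel_shift`
(`LatticeTraceGeometry.lean`), `bondPercolation_real_preimage_shift`, `sym2Equiv`, `Site.shift`.
-/

noncomputable section

namespace Literature.Probability.Percolation

open _root_.MeasureTheory Set LatticeModels

/-- **The polychromatic four-arm event around `c`** in cluster form: two open crossings of the
annulus `c + A_{m,n}` from `‖· - c‖_∞ = m` to `‖· - c‖_∞ = n` whose inner endpoints are not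
joined by an open path of `c + A_{m,n}` — Garban's `P⁴(c, r, R)` rendered as
`fourArmTwoClusters` (`FourArmGarban.lean`) recentred at `c`. [cite: SchrammSmirnov2011, (1.3) and Appendix B, (B.2) (the four-arm event at z)] -/
def fourArmTwoClustersAt (c : Site 2) (m n : ℕ) : Set (BondConfig (Site 2)) :=
  {ω | ∃ x₁, x₁ - c ∈ siteSphere m ∧ ∃ x₂, x₂ - c ∈ siteSphere m ∧
    ∃ y₁, y₁ - c ∈ siteSphere n ∧ ∃ y₂, y₂ - c ∈ siteSphere n ∧
      ω ∈ openConnIn ((· + c) '' sqAnnulus m n) x₁ y₁ ∧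
      ω ∈ openConnIn ((· + c) '' sqAnnulus m n) x₂ y₂ ∧
      ω ∉ openConnIn ((· + c) '' sqAnnulus m n) x₁ x₂}

/-- Around the origin, `fourArmTwoClustersAt` is `fourArmTwoClusters`. [folklore] -/
theorem fourArmTwoClustersAt_zero (m n : ℕ) : fourArmTwoClustersAt 0 m n = fourArmTwoClusters m n := by
  ext ω
  have himg : ((· + (0 : Site 2)) '' sqAnnulus m n) = sqAnnulus m n := by
    rw [show (fun x : Site 2 => x + 0) = id from funext fun x => add_zero x, Set.image_id]
  simp only [fourArmTwoClustersAt, fourArmTwoClusters, sub_zero, himg, mem_setOf_eq]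

/-- The translated annulus, translated once more. [folklore] -/
theorem image_shift_image_add (c v : Site 2) (S : Set (Site 2)) :
    (Site.shift v) '' ((· + c) '' S) = (· + (c + v)) '' S := by
  rw [Set.image_image]
  refine congrArg (fun f => f '' S) (funext fun x => ?_)
  show x + c + v = x + (c + v)
  rw [add_assoc]

/-- **Transport by translation**: shifting the configuration by `v` carries the four arms around
`c` to four arms around `c + v`. [folklore] -/
theorem relabel_shift_mem_fourArmTwoClustersAt {c v : Site 2} {m n : ℕ} {ω : BondConfig (Site 2)}
    (h : ω ∈ fourArmTwoClustersAt c m n) :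
    BondConfig.relabel (sym2Equiv (Site.shift v)) ω ∈ fourArmTwoClustersAt (c + v) m n := by
  obtain ⟨x₁, hx₁, x₂, hx₂, y₁, hy₁, y₂, hy₂, h₁, h₂, h₁₂⟩ := h
  have hsub : ∀ x : Site 2, Site.shift v x - (c + v) = x - c := fun x => by
    show x + v - (c + v) = x - c
    abel
  refine ⟨Site.shift v x₁, by rw [hsub]; exact hx₁, Site.shift v x₂, by rw [hsub]; exact hx₂,
    Site.shift v y₁, by rw [hsub]; exact hy₁, Site.shift v y₂, by rw [hsub]; exact hy₂, ?_, ?_, ?_⟩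
  · have := relabel_mem_openConnIn (Site.shift v) h₁
    rwa [image_shift_image_add] at this
  · have := relabel_mem_openConnIn (Site.shift v) h₂
    rwa [image_shift_image_add] at this
  · intro h
    apply h₁₂
    have h' := relabel_mem_openConnIn (Site.shift (-v)) h
    rw [image_shift_image_add, add_neg_cancel_right] at h'
    have hω : BondConfig.relabel (sym2Equiv (Site.shift (-v)))
        (BondConfig.relabel (sym2Equiv (Site.shift v)) ω) = ω := by
      simpa using relabel_shift_neg_relabel_shift v ω
    have hx : Site.shift (-v) (Site.shift v x₁) = x₁ := by simp
    have hx' : Site.shift (-v) (Site.shift v x₂) = x₂ := by simp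
    rwa [hω, hx, hx'] at h'

/-- **The event around `c` as a translate of the event around the origin**: `ω` has four arms
around `c` iff `ω - c` has four arms around `0`. [folklore] -/
theorem fourArmTwoClustersAt_eq_preimage (c : Site 2) (m n : ℕ) :
    fourArmTwoClustersAt c m n =
      BondConfig.relabel (sym2Equiv (Site.shift (-c))) ⁻¹' fourArmTwoClusters m n := by
  ext ω
  rw [mem_preimage, ← fourArmTwoClustersAt_zero]
  constructor
  · intro h
    have := relabel_shift_mem_fourArmTwoClustersAt (v := -c) h
    rwa [add_neg_cancel] at this
  · intro h
    have := relabel_shift_mem_fourArmTwoClustersAt (v := c) h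
    rw [zero_add] at this
    have hω : BondConfig.relabel (sym2Equiv (Site.shift c))
        (BondConfig.relabel (sym2Equiv (Site.shift (-c))) ω) = ω := by
      simpa using relabel_shift_neg_relabel_shift (-c) ω
    rwa [hω] at this

/-- **Translation invariance of the four-arm probability**: for every `p` and every centre `c`,
`P_p(fourArmTwoClustersAt c m n) = P_p(fourArmTwoClusters m n)` (Grimmett 1999, §1.6). This is
the first step of any proof of Garban's (B.2) from `fourArmTwoClusters`. [cite: SchrammSmirnov2011, Appendix B, (B.2)] -/
theorem real_fourArmTwoClustersAt (p : unitInterval) (c : Site 2) (m n : ℕ) :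
    (bondPercolation (zdGraph 2) p).real (fourArmTwoClustersAt c m n) =
      (bondPercolation (zdGraph 2) p).real (fourArmTwoClusters m n) := by
  rw [fourArmTwoClustersAt_eq_preimage, bondPercolation_real_preimage_shift]

end Literature.Probability.Percolation
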